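import Literature.AlgebraicGeometry.GaoUllmo2025.GaloisSigns
import Literature.AlgebraicGeometry.GaoUllmo2025.RationalCoefficients
import Mathlib.RingTheory.Discriminant
import HarnessLib

/-!
# Gao–Ullmo 2025, Theorem 3.1 (Pohlmann's theorem, CM-algebra form) — statement and kernel proof

Z. Gao, E. Ullmo, *Hodge cycles and quadratic relations between holomorphic periods on CM abelian varieties*,
J. Inst. Math. Jussieu **25** (2025), no. 1, 215–249, doi:10.1017/S1474748025101291 = arXiv:2411.12249
[GaoUllmo2025], §3.1, art. p. 11 (held published text `corpus:paper:galaxy-pdf-4667137180`, chunk p0012 L3–L8;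
arXiv text `corpus:paper:arxiv-2411.12249`, chunk p0009 L32–L44), VERBATIM:

"Let `A` be a CM abelian variety, associated with the CM pair `(E, Φ)`. Let `E^c` be the Galois closure of `E` …
and let `G = Gal(E^c/ℚ)`. […] **Theorem 3.1** (Pohlmann). For each `p ≥ 0`, the vector space `B^p(A) ⊗ ℂ` has a
basis consisting of `[P]` for those ordered sets `P ∈ 𝒫(S)` with `|P| = 2p` such that
(3.2) `|σP ∩ Φ| = |σP ∩ Φ̄|` for all `σ ∈ G`.
In particular `dim_ℚ B^p(A)` is the number of ordered `P ∈ 𝒫(S)` with `|P| = 2p` satisfying (3.2)."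

"**Proof.** Pohlmann [Poh68, Thm. 1] states this result when `A` is simple. The proof remains valid for an arbitrary
CM abelian variety `A`. To make the paper more self-contained, we include the proof here." (chunk p0012 L10) —
followed by the half-page Galois-descent argument formalised in `GaloisSigns` (first paragraph),
`ClosureEmbeddings` + `RationalCoefficients` (the rationality of `f_j := Σ_σ σ(u_j)[σP]`) and this module
("`f_j ∈ H^{p,p}(A, ℂ)` by (3.2). So `f_j ∈ B^p(A)`. But `det(σ(u_j))_{σ,j} ≠ 0`, we can solve the linear system
`f_j = Σ_{σ ∈ G} σ(u_j)[σP]`, and find that `[σP] ∈ B^p(A) ⊗ ℂ` for each `σ ∈ G`. In particular,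
`[P] ∈ B^p(A) ⊗ ℂ`. We are done.", chunk p0012 L14–L16).  [Poh68] = H. Pohlmann, *Algebraic cycles on abelian
varieties of complex multiplication type*, Ann. of Math. (2) 88 (1968) 161–180, Thm 1 — quoted here ONLY through
Gao–Ullmo's sentence above (the 1968 text is not held).

SCOPE.  The hypothesis of `theorem31` is exactly the printed one: `E` a CM ALGEBRA (`IsCMAlgebra E`, §2.1 — "an
arbitrary CM abelian variety `A`", simple or not), `Φ` a CM type on `E`, `S = Hom(E, ℂ)` ordered with `Φ` before `Φ̄`
(`OrderConvention`), any `p`.  Over the typed model (`CMHodgeModel`: `Hr E (2p) = H^{2p}(A, ℂ) = ⋀^{2p} ℂ^S`,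
`Bp Φ p = H^{2p}(A, ℚ) ∩ H^{p,p}(A, ℂ)`, `wedge` = `[P]`, `SatisfiesEq32` = (3.2)) the conclusion reads: the `ℂ`-span of
`B^p(A)` EQUALS the `ℂ`-span of the `[P]`, `|P| = 2p`, satisfying (3.2); since the `[P]` are members of a basis of
`⋀^{2p} ℂ^S` (`linearIndependent_wedge`), "span = span" is exactly "these `[P]` form a basis of `B^p(A) ⊗ ℂ`".  The
"In particular" clause (`dim_ℚ`) is `Literature.AlgebraicGeometry.GaoUllmo2025.Theorem31Finrank.theorem31_finrank`.
FREE STRENGTHENING: the formal proof never uses the ordering convention, so `span_Bp_eq_span_wedge` states the same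
equality for ANY linear order on `S`.

This module's own steps (second half, `⊇`): a `2p`-set with `|Q ∩ Φ| = |Q ∩ Φ̄|` has type `(p,p)`
(`type_of_card_eq`); `ρ[P] = ±[σ_ρ P] ∈ H^{p,p}` when `P` satisfies (3.2) (`Tvec_mem_Hpp`); hence `f_u ∈ B^p(A)`
(`fvec_mem_Bp`); and `[P]` is recovered from the `f_{u_j}` by inverting `(ρ_l(u_j))_{j,l}`, whose determinant squared
is the discriminant of the basis `(u_j)` of `E^c/ℚ`, non-zero (`wedge_mem_span_fvec`, Mathlib
`Algebra.discr_not_zero_of_basis`) — the printed "`det(σ(u_j))_{σ,j} ≠ 0`".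

## References

* [GaoUllmo2025] Z. Gao, E. Ullmo, J. Inst. Math. Jussieu 25 (2025) 215–249 — Theorem 3.1 (Pohlmann) and its
  proof, §3.1, art. p. 11.
* [Pohlmann1968] H. Pohlmann, Ann. of Math. (2) 88 (1968) 161–180, Thm 1 — original source named by [GaoUllmo2025];
  not read, quotation-only.

## Provenance

Staged by the pub-hodgecm formalisation cell (lineage `pub-hodgecm-pohl`) under the LEAN-IN-TREE rule; supersedes
§Final and `span_Bp_eq_span_wedge` of the standalone package's `HodgeCM/Literature/GaoUllmoTheorem31.lean` (gate run
20/21) and the named proposition `HodgeCM.GaoUllmo.Theorem31` of `HodgeCM/Literature/GaoUllmo.lean` (gate run 24),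
which is stated here DIRECTLY as the theorem `theorem31` (same binders and conclusion; D-0026), namespace
`HodgeCM.GaoUllmo` ↦ `Literature.AlgebraicGeometry.GaoUllmo2025`.
-/

noncomputable section

open Module

attribute [local instance] Classical.propDecidable

namespace Literature.AlgebraicGeometry.GaoUllmo2025

section Final

variable {E : Type} [CommRing E] [Algebra ℚ E] [Module.Finite ℚ E] [LinearOrder (Emb E)]

omit [Module.Finite ℚ E] [LinearOrder (Emb E)] in
/-- A set of cardinality `2p` satisfying `|Q ∩ Φ| = |Q ∩ Φ̄|` has type `(p,p)`. [folklore] -/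
theorem type_of_card_eq (Φ : CMTypeOn E) {p : ℕ} (Q : Finset (Emb E)) (hcard : Q.card = 2 * p)
    (h : (Q ∩ Φ.Φ).card = (Q ∩ Φ.bar).card) : (Q ∩ Φ.Φ).card = p ∧ (Q ∩ Φ.bar).card = p := by
  have h1 : Q ∩ Φ.Φ = Q.filter (fun φ => φ ∈ Φ.Φ) := by
    ext φ; simp [Finset.mem_filter]
  have h2 : Q ∩ Φ.bar = Q.filter (fun φ => ¬ φ ∈ Φ.Φ) := by
    ext φ; simp [Finset.mem_filter, CMTypeOn.mem_bar_iff]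
  have hsum := Finset.card_filter_add_card_filter_not (s := Q) (fun φ => φ ∈ Φ.Φ)
  rw [← h1, ← h2, hcard] at hsum
  omega

/-- `ρ[P] = ± [σ_ρ P]`; hence, if `P` satisfies (3.2), `ρ[P] ∈ H^{p,p}` (the printed "`f_j ∈ H^{p,p}(A, ℂ)` by
(3.2)", chunk p0012 L14). [cite: GaoUllmo2025, Thm 3.1 (proof, second paragraph)] -/
theorem Tvec_mem_Hpp (Φ : CMTypeOn E) (p : ℕ) (P : Set.powersetCard (Emb E) (2 * p))
    (h32 : SatisfiesEq32 Φ (P : Finset (Emb E))) (ρ : galoisClosure E →ₐ[ℚ] ℂ) :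
    Tvec (2 * p) P ρ ∈ Hpp Φ p := by
  obtain ⟨π, hπ⟩ := exists_perm_enum (autOfEmb ρ) P
  set Q := galActPC (autOfEmb ρ) P with hQ
  have hfun : (fun k => e E (embAct ρ (Set.powersetCard.ofFinEmbEquiv.symm P k))) =
      (fun k => e E (Set.powersetCard.ofFinEmbEquiv.symm Q k)) ∘ π := by
    funext k
    simp only [Function.comp_apply]
    rw [← galAct_autOfEmb, hπ k]
  have hT : Tvec (2 * p) P ρ = (Equiv.Perm.sign π : ℤˣ) • wedge E (2 * p) Q := by
    unfold Tvec
    rw [hfun, AlternatingMap.map_perm]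
    congr 1
    simp only [wedge, exteriorPower.basis_apply]
    rfl
  have htype : ((Q : Finset (Emb E)) ∩ Φ.Φ).card = p ∧ ((Q : Finset (Emb E)) ∩ Φ.bar).card = p :=
    type_of_card_eq Φ _ Q.prop (by rw [hQ, galActPC_val]; exact h32 (autOfEmb ρ))
  rw [hT, Units.smul_def]
  apply Submodule.smul_of_tower_mem
  exact Submodule.subset_span ⟨Q, htype.1, htype.2, rfl⟩

/-- `f_u ∈ B^p(A)` for every `u ∈ E^c`, when `P` satisfies (3.2) (the printed "So `f_j ∈ B^p(A)`", chunk p0012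
L14). [cite: GaoUllmo2025, Thm 3.1 (proof, second paragraph)] -/
theorem fvec_mem_Bp (hE : IsCMAlgebra E) (Φ : CMTypeOn E) (p : ℕ) (P : Set.powersetCard (Emb E) (2 * p))
    (h32 : SatisfiesEq32 Φ (P : Finset (Emb E))) (u : galoisClosure E) : fvec (2 * p) P u ∈ Bp Φ p := by
  refine Submodule.mem_inf.mpr ⟨fvec_mem_ratStr hE (2 * p) P u, ?_⟩
  show fvec (2 * p) P u ∈ Hpp Φ p
  unfold fvec
  exact Submodule.sum_mem _ fun ρ _ => Submodule.smul_mem _ _ (Tvec_mem_Hpp Φ p P h32 ρ)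

/-- **Inversion** (the printed "`det(σ(u_j))_{σ,j} ≠ 0`, we can solve the linear system", chunk p0012 L14–L16):
`[P]` is a `ℂ`-combination of the `f_{u_j}`, `u_j` a `ℚ`-basis of `E^c` — `det² = disc(u_j) ≠ 0`.
[cite: GaoUllmo2025, Thm 3.1 (proof, second paragraph)] -/
theorem wedge_mem_span_fvec (r : ℕ) (P : Set.powersetCard (Emb E) r) :
    wedge E r P ∈ Submodule.span ℂ (Set.range fun u : galoisClosure E => fvec r P u) := by
  set d := finrank ℚ (galoisClosure E)
  set uB : Basis (Fin d) ℚ (galoisClosure E) := Module.finBasis ℚ (galoisClosure E)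
  have hcard : Fintype.card (Fin d) = Fintype.card (galoisClosure E →ₐ[ℚ] ℂ) := by
    rw [Fintype.card_fin, AlgHom.card]
  set ε : Fin d ≃ (galoisClosure E →ₐ[ℚ] ℂ) := Fintype.equivOfCardEq hcard
  set U : Matrix (Fin d) (Fin d) ℂ := Algebra.embeddingsMatrixReindex ℚ ℂ (⇑uB) ε with hU
  have hUapply : ∀ j l, U j l = (ε l) (uB j) := by
    intro j l; simp [hU, Algebra.embeddingsMatrixReindex, Algebra.embeddingsMatrix]
  have hdet : U.det ≠ 0 := by
    intro h0
    have h1 := Algebra.discr_eq_det_embeddingsMatrixReindex_pow_two ℚ ℂ (⇑uB) ε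
    rw [← hU, h0, zero_pow two_ne_zero, map_eq_zero] at h1
    exact Algebra.discr_not_zero_of_basis ℚ uB h1
  have hfvec : ∀ j, fvec r P (uB j) = ∑ l, U j l • Tvec r P (ε l) := by
    intro j
    unfold fvec
    rw [← Equiv.sum_comp ε]
    simp_rw [hUapply]
  set V := U⁻¹
  have hVU : V * U = 1 := Matrix.nonsing_inv_mul _ (isUnit_iff_ne_zero.mpr hdet)
  set l₀ := ε.symm (galoisClosure E).val
  have hcomb : ∑ j, V l₀ j • fvec r P (uB j) = wedge E r P := by
    simp_rw [hfvec, Finset.smul_sum, smul_smul]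
    rw [Finset.sum_comm]
    have : ∀ l, ∑ j, (V l₀ j * U j l) • Tvec r P (ε l) = ((V * U) l₀ l) • Tvec r P (ε l) := by
      intro l; rw [← Finset.sum_smul, Matrix.mul_apply]
    simp_rw [this, hVU, Matrix.one_apply, ite_smul, one_smul, zero_smul, Finset.sum_ite_eq, Finset.mem_univ,
      if_true]
    rw [show ε l₀ = (galoisClosure E).val by simp [l₀], Tvec_val]
  rw [← hcomb]
  exact Submodule.sum_mem _ fun j _ => Submodule.smul_mem _ _ (Submodule.subset_span ⟨uB j, rfl⟩)

/-- **Theorem 3.1, second half (`⊇`)** pointwise (the printed "It remains to prove that `[P] ∈ B^p(A) ⊗ ℂ` for each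
`P ∈ 𝒫(S)` with `|P| = 2p` satisfying (3.2)", chunk p0012 L14): `[P] ∈ B^p(A) ⊗ ℂ`.
[cite: GaoUllmo2025, Thm 3.1] -/
theorem wedge_mem_span_Bp (hE : IsCMAlgebra E) (Φ : CMTypeOn E) (p : ℕ) (P : Set.powersetCard (Emb E) (2 * p))
    (h32 : SatisfiesEq32 Φ (P : Finset (Emb E))) :
    wedge E (2 * p) P ∈ Submodule.span ℂ (Bp Φ p : Set (Hr E (2 * p))) := by
  refine Submodule.span_mono ?_ (wedge_mem_span_fvec (2 * p) P)
  rintro _ ⟨u, rfl⟩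
  exact fvec_mem_Bp hE Φ p P h32 u

/-- **Theorem 3.1 without the ordering convention** (a free strengthening: neither half of the formal proof uses
`OrderConvention Φ`, the wedge basis being defined for ANY linear order on `S`): for a CM algebra `E`, a CM type
`Φ` and any `p`, `B^p(A) ⊗ ℂ = span_ℂ {[P] : |P| = 2p, (3.2)}` inside `H^{2p}(A, ℂ)`. [cite: GaoUllmo2025, Thm 3.1] -/
theorem span_Bp_eq_span_wedge (hE : IsCMAlgebra E) (Φ : CMTypeOn E) (p : ℕ) :
    Submodule.span ℂ (Bp Φ p : Set (Hr E (2 * p))) =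
      Submodule.span ℂ {x | ∃ P : Set.powersetCard (Emb E) (2 * p),
        SatisfiesEq32 Φ (P : Finset (Emb E)) ∧ x = wedge E (2 * p) P} := by
  refine le_antisymm (span_Bp_le Φ p) ?_
  rw [Submodule.span_le]
  rintro _ ⟨P, h32, rfl⟩
  exact wedge_mem_span_Bp hE Φ p P h32

end Final

/-- **Gao–Ullmo, J. Inst. Math. Jussieu 25 (2025) 215–249, Theorem 3.1 "(Pohlmann)"** (§3.1, art. p. 11, chunk
p0012 L3–L6; arXiv:2411.12249 chunk p0009 L32–L37), VERBATIM: "**Theorem 3.1** (Pohlmann). For each `p ≥ 0`, the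
vector space `B^p(A) ⊗ ℂ` has a basis consisting of `[P]` for those ordered sets `P ∈ 𝒫(S)` with `|P| = 2p` such
that (3.2) `|σP ∩ Φ| = |σP ∩ Φ̄|` for all `σ ∈ G`."  For every CM algebra `E`, every CM type `Φ` on `E`, every
ordering of `S = Hom(E, ℂ)` obeying the paper's convention, and every `p`: the `ℂ`-span of
`B^p(A) = H^{2p}(A, ℚ) ∩ H^{p,p}(A, ℂ)` inside `H^{2p}(A, ℂ) = ⋀^{2p} ℂ^S` equals the `ℂ`-span of the (linearly
independent) vectors `[P]`, `|P| = 2p`, satisfying (3.2).  KERNEL-PROVED (`span_Bp_eq_span_wedge`); the binders and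
conclusion are those of the standalone package's named proposition `HodgeCM.GaoUllmo.Theorem31`.
[cite: GaoUllmo2025, Thm 3.1] -/
theorem theorem31 :
    ∀ (E : Type) [CommRing E] [Algebra ℚ E] [Module.Finite ℚ E] [LinearOrder (Emb E)], IsCMAlgebra E →
      ∀ (Φ : CMTypeOn E), OrderConvention Φ → ∀ p : ℕ,
        Submodule.span ℂ (Bp Φ p : Set (Hr E (2 * p))) =
          Submodule.span ℂ {x | ∃ P : Set.powersetCard (Emb E) (2 * p),
            SatisfiesEq32 Φ (P : Finset (Emb E)) ∧ x = wedge E (2 * p) P} :=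
  fun _E _ _ _ _ hE Φ _ p => span_Bp_eq_span_wedge hE Φ p

end Literature.AlgebraicGeometry.GaoUllmo2025

end
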